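import Summits.Ventures.HSemireg.WedgeHankelRecurrenceGaussHurwitzStable

/-!
# Venture HSemireg — **DIVISION BY A LINEAR FACTOR (Geronimus ∕ Uvarov)**: for a positive discrete measure `(ν, w)` with orthogonal polynomials `q_n, q_{n+1}` and a real `c ∉ {w_l}`, put
# `F_k(c) = Σ_l ν_l q_k(w_l) ∕ (w_l − c)`.  Then `q_n(c) F_n(c) = Σ_l ν_l q_n(w_l)² ∕ (w_l − c)` (so `F_n(c) ≠ 0` when `c` lies below the support), and for `F_n(c) ≠ 0` the polynomial
# `q̂_{n+1} = q_{n+1} − (F_{n+1}(c) ∕ F_n(c)) q_n` is orthogonal to every `G` with `deg G ≤ n` for the measure `ν ∕ (w − c)`; for `c < min_l w_l` it is THE monic orthogonal polynomial of degree `n + 1`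

HONEST FRAMING. Part of the Lean index of the computation cell `pub-hsemireg` (seat p10 gen 43, Sunday typer «UNIFORM-IN-n»).  Real polynomials and finite sums only; no variety, no cohomology
theory, no sheaf, no Ext group and no semiregularity map is constructed here; nothing here says that HC / HC_CM / HC_AV holds; no Literature fact (unproved `Prop`) is declared or used.  Custodian
versions as in `WedgeHankelSiegelIdeal` (1/3).
SOURCES (cited).  Ya. L. Geronimus, *On polynomials orthogonal with regard to a given sequence of numbers and a theorem by W. Hahn*, Izv. Akad. Nauk SSSR 4 (1940) 215–228; V. B. Uvarov, USSR Comput.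
Math. Math. Phys. 9 (1969) 25–36 (rational modifications of the weight); W. Gautschi, *Orthogonal Polynomials: Computation and Approximation* (2004), §2.4.5 (modification by a linear divisor);
G. Szegő, *Orthogonal Polynomials*, §3.5 ∕ (3.5.2) (functions of the second kind); A. Markov, *Lectures on continued fractions* (the sign of `∫ q_n² ∕ (c − x)`).
PROOF TYPED HERE.  `(q_n(w) − q_n(c)) ∕ (w − c)` and `(G(w) − G(c)) ∕ (w − c)` are polynomials of degree `< n` (Mathlib `mul_divByMonic_eq_iff_isRoot` for `X − C c`), against which `q_n`, `q_{n+1}` are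
orthogonal; what is left is `G(c) (F_{n+1}(c) − r F_n(c)) = 0` by the choice `r = F_{n+1}(c) ∕ F_n(c)`; uniqueness by N290 `orthogonal_monic_unique` for the positive measure `(ν ∕ (w − c), w)`.
DEDUP DISCLOSURE (`rg -n 'geronimus|linear_divisor|sum_div_sub' Summits/Ventures/HSemireg Literature`, 2026-09-03): N276 `gauss_radau` and N304 (Christoffel) MULTIPLY the measure by `(w − c)`; division is
new.  The 5 names below: 0 hits tree-wide.

WHAT IS IN THE TREE.  N273 `sum_mul_eval_sq_pos_of_natDegree_lt`; N290 `orthogonal_monic_unique`; Mathlib `Polynomial.mul_divByMonic_eq_iff_isRoot`, `Polynomial.natDegree_divByMonic`, `monic_X_sub_C`,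
`Polynomial.Monic.sub_of_left`, `Polynomial.natDegree_sub_eq_left_of_natDegree_lt`.
THIS FILE (namespace `Summit.Ventures.HSemireg.Wedge.HankelOuter` continued; CHAINED on N306 (import), N273, N290; 0 definitions — `F_k(c)` and `q̂` written inline):
* §1072 `exists_quotient_sub_eval` (`P − P(c) = (X − c) · D` with `deg D < deg P` when `deg P ≥ 1`, `D = 0` when `P` is constant), **`eval_mul_secondKindSum_eq`** (`q_n(c) F_n(c) = Σ_l ν_l q_n(w_l)² ∕ (w_l − c)`
  when `q_n ⟂` lower degrees), `secondKindSum_ne_zero` (`c` below the support, `ν > 0` ⇒ `q_n(c) F_n(c) > 0`, so `F_n(c) ≠ 0`), **`geronimus_orthogonal`** (`Σ_l (ν_l ∕ (w_l − c)) (q̂ G)(w_l) = 0`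
  for `deg G ≤ n`), **`geronimus_theorem`** (for `c < min w`: the monic orthogonal polynomial of degree `n + 1` of `ν ∕ (w − c)` is `q̂_{n+1} = q_{n+1} − (F_{n+1}(c) ∕ F_n(c)) q_n`).
CAVEATS.  One linear divisor with `c` off the atoms; positivity of `ν ∕ (w − c)` (i.e. `c` below the support) only for the uniqueness statement.  Nothing Ext-side.  New names only.
-/

open Module Polynomial
open scoped Matrix Polynomial

namespace Summit.Ventures.HSemireg.Wedge.HankelOuter

/-! ## §1072. Division of the measure by `(w − c)`: Geronimus ∕ Uvarov -/

/-- **`P − P(c) = (X − c) · D` with `deg D ≤ deg P − 1`** (`D = (P − C P(c)) /ₘ (X − C c)`). [mechanism; this file, §1072] -/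
theorem exists_quotient_sub_eval (P : ℝ[X]) (c : ℝ) :
    ∃ D : ℝ[X], P - C (P.eval c) = (Polynomial.X - C c) * D ∧ D.natDegree ≤ P.natDegree - 1 := by
  refine ⟨(P - C (P.eval c)) /ₘ (Polynomial.X - C c), ?_, ?_⟩
  · exact ((mul_divByMonic_eq_iff_isRoot (a := c) (p := P - C (P.eval c))).2 (by simp [IsRoot])).symm
  · rw [natDegree_divByMonic _ (monic_X_sub_C c), natDegree_X_sub_C]
    exact Nat.sub_le_sub_right ((natDegree_sub_le _ _).trans (by rw [natDegree_C]; exact max_le le_rfl (Nat.zero_le _))) 1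

/-- **`q_n(c) · F_n(c) = Σ_l ν_l q_n(w_l)² ∕ (w_l − c)`** with `F_n(c) = Σ_l ν_l q_n(w_l) ∕ (w_l − c)`, whenever `q_n` (`deg q_n = n`) is `(ν, w)`-orthogonal to all lower degrees and `c ∉ {w_l}`
(the difference quotient `(q_n − q_n(c)) ∕ (X − c)` has degree `< n`). [Szegő (3.5.2); Markov; this file, §1072] -/
theorem eval_mul_secondKindSum_eq {N n : ℕ} {ν w : Fin N → ℝ} {Q : ℝ[X]} (hQd : Q.natDegree = n) (hQo : ∀ G : ℝ[X], G.natDegree < n → ∑ l, ν l * (Q * G).eval (w l) = 0)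
    {c : ℝ} (hwc : ∀ l, w l ≠ c) :
    Q.eval c * ∑ l, ν l * Q.eval (w l) / (w l - c) = ∑ l, ν l * (Q.eval (w l)) ^ 2 / (w l - c) := by
  rcases Nat.eq_zero_or_pos n with h0 | hpos
  · -- `Q` is constant
    subst h0
    have hQ := eq_C_of_natDegree_eq_zero hQd
    rw [Finset.mul_sum]
    refine Finset.sum_congr rfl fun l _ => ?_
    rw [hQ, eval_C, eval_C]; ring
  · obtain ⟨D, hD, hDd⟩ := exists_quotient_sub_eval Q c
    have hDd' : D.natDegree < n := by rw [hQd] at hDd; omega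
    have horth := hQo D hDd'
    -- `Q(w) − Q(c) = (w − c) D(w)`
    have hl : ∀ l, ν l * (Q.eval (w l)) ^ 2 / (w l - c) - Q.eval c * (ν l * Q.eval (w l) / (w l - c)) = ν l * (Q * D).eval (w l) := fun l => by
      have hwc' : w l - c ≠ 0 := sub_ne_zero.2 (hwc l)
      have hev := congrArg (fun F => F.eval (w l)) hD
      simp only [eval_sub, eval_mul, eval_X, eval_C] at hev
      rw [eval_mul]
      field_simp
      linear_combination (ν l * Q.eval (w l)) * hev
    have hsum : ∑ l, ν l * (Q.eval (w l)) ^ 2 / (w l - c) - Q.eval c * ∑ l, ν l * Q.eval (w l) / (w l - c) = 0 := by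
      rw [Finset.mul_sum, ← Finset.sum_sub_distrib, Finset.sum_congr rfl fun l _ => hl l, horth]
    linarith

/-- **`F_n(c) ≠ 0` below the support**: if `ν_l > 0`, `c < w_l` for all `l`, and `q_n ≠ 0` is orthogonal to lower degrees (`deg q_n = n < N`, `w` injective), then `q_n(c) F_n(c) > 0`; in
particular `F_n(c) ≠ 0` (and `q_n(c) ≠ 0`). [Markov; Szegő §3.5; this file, §1072] -/
theorem secondKindSum_ne_zero {N n : ℕ} {ν w : Fin N → ℝ} (hν : ∀ l, 0 < ν l) (hw : Function.Injective w) (hnN : n < N) {Q : ℝ[X]} (hQ : Q ≠ 0) (hQd : Q.natDegree = n)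
    (hQo : ∀ G : ℝ[X], G.natDegree < n → ∑ l, ν l * (Q * G).eval (w l) = 0) {c : ℝ} (hcw : ∀ l, c < w l) :
    0 < Q.eval c * ∑ l, ν l * Q.eval (w l) / (w l - c) ∧ ∑ l, ν l * Q.eval (w l) / (w l - c) ≠ 0 := by
  have h := eval_mul_secondKindSum_eq hQd hQo (fun l => (hcw l).ne')
  have hpos : 0 < ∑ l, ν l * (Q.eval (w l)) ^ 2 / (w l - c) := by
    have h' : ∑ l, ν l * (Q.eval (w l)) ^ 2 / (w l - c) = ∑ l, (ν l / (w l - c)) * (Q.eval (w l)) ^ 2 := Finset.sum_congr rfl fun l _ => by ring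
    rw [h']
    exact sum_mul_eval_sq_pos_of_natDegree_lt (fun l => div_pos (hν l) (sub_pos.2 (hcw l))) hw hQ (by rw [hQd]; exact hnN)
  rw [h]
  exact ⟨hpos, fun h0 => by rw [h0, mul_zero] at h; exact hpos.ne h⟩

/-- **GERONIMUS ∕ UVAROV: division by `(w − c)`.**  If `q_n`, `q_{n+1}` (degrees `n`, `n + 1`) are `(ν, w)`-orthogonal to all lower degrees, `c ∉ {w_l}` and `F_n(c) = Σ_l ν_l q_n(w_l) ∕ (w_l − c) ≠ 0`, then
`q̂ = q_{n+1} − (F_{n+1}(c) ∕ F_n(c)) q_n` satisfies `Σ_l (ν_l ∕ (w_l − c)) (q̂ · G)(w_l) = 0` for every `G` with `deg G ≤ n`. [Geronimus 1940; Uvarov 1969; Gautschi §2.4.5; this file, §1072] -/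
theorem geronimus_orthogonal {N n : ℕ} {ν w : Fin N → ℝ} {q : ℕ → ℝ[X]} (hdeg : ∀ k, k ≤ n + 1 → (q k).natDegree = k)
    (horth : ∀ k, k ≤ n + 1 → ∀ G : ℝ[X], G.natDegree < k → ∑ l, ν l * (q k * G).eval (w l) = 0) {c : ℝ} (hwc : ∀ l, w l ≠ c)
    (hF : ∑ l, ν l * (q n).eval (w l) / (w l - c) ≠ 0) {G : ℝ[X]} (hG : G.natDegree ≤ n) :
    ∑ l, (ν l / (w l - c)) * ((q (n + 1) - C ((∑ l, ν l * (q (n + 1)).eval (w l) / (w l - c)) / ∑ l, ν l * (q n).eval (w l) / (w l - c)) * q n) * G).eval (w l) = 0 := by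
  set Fn : ℝ := ∑ l, ν l * (q n).eval (w l) / (w l - c) with hFn
  set Fn1 : ℝ := ∑ l, ν l * (q (n + 1)).eval (w l) / (w l - c) with hFn1
  obtain ⟨D, hD, hDd⟩ := exists_quotient_sub_eval G c
  have hDd' : D.natDegree < n ∨ D = 0 := by
    rcases Nat.eq_zero_or_pos n with h0 | hpos
    · right
      subst h0
      have hG0 := eq_C_of_natDegree_eq_zero (Nat.le_zero.1 hG)
      have : (Polynomial.X - C c) * D = 0 := by rw [← hD, hG0, eval_C, sub_self]
      exact (mul_eq_zero.1 this).resolve_left (X_sub_C_ne_zero c)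
    · left; omega
  have h1 : ∑ l, ν l * (q (n + 1) * D).eval (w l) = 0 := by
    rcases hDd' with h | h
    · exact horth (n + 1) le_rfl D (by omega)
    · simp [h]
  have h0 : ∑ l, ν l * (q n * D).eval (w l) = 0 := by
    rcases hDd' with h | h
    · exact horth n (by omega) D h
    · simp [h]
  -- split `G(w) = G(c) + (w − c) D(w)` under the divided measure
  have hl : ∀ l, (ν l / (w l - c)) * ((q (n + 1) - C (Fn1 / Fn) * q n) * G).eval (w l) =
      G.eval c * (ν l * (q (n + 1)).eval (w l) / (w l - c)) - G.eval c * (Fn1 / Fn) * (ν l * (q n).eval (w l) / (w l - c)) +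
        (ν l * (q (n + 1) * D).eval (w l) - (Fn1 / Fn) * (ν l * (q n * D).eval (w l))) := fun l => by
    have hwc' : w l - c ≠ 0 := sub_ne_zero.2 (hwc l)
    have hev := congrArg (fun F => F.eval (w l)) hD
    simp only [eval_sub, eval_mul, eval_X, eval_C] at hev
    have hGw : G.eval (w l) = G.eval c + (w l - c) * D.eval (w l) := by linarith [hev]
    simp only [eval_mul, eval_sub, eval_C]
    rw [hGw]
    field_simp
  rw [Finset.sum_congr rfl fun l _ => hl l, Finset.sum_add_distrib, Finset.sum_sub_distrib, Finset.sum_sub_distrib, ← Finset.mul_sum, ← Finset.mul_sum, ← Finset.mul_sum, h1, h0,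
    ← hFn, ← hFn1, mul_zero, sub_zero, add_zero, mul_assoc, div_mul_cancel₀ _ hF, sub_self]

/-- **GERONIMUS' THEOREM (c below the support).**  Let `ν_l > 0` on `N` distinct nodes `w_l`, `n + 1 ≤ N`, `c < w_l` for all `l`, and let `q_n`, `q_{n+1}` be monic of degrees `n`, `n + 1`,
`(ν, w)`-orthogonal to all lower degrees.  Then the monic polynomial `Q` of degree `n + 1` orthogonal to all lower degrees for the measure `(ν ∕ (w − c), w)` is
`q_{n+1} − (F_{n+1}(c) ∕ F_n(c)) q_n`, `F_k(c) = Σ_l ν_l q_k(w_l) ∕ (w_l − c)`. [Geronimus 1940; Gautschi §2.4.5; this file, §1072] -/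
theorem geronimus_theorem {N n : ℕ} {ν w : Fin N → ℝ} (hν : ∀ l, 0 < ν l) (hw : Function.Injective w) (hnN : n + 1 ≤ N) {q : ℕ → ℝ[X]}
    (hmonic : ∀ k, k ≤ n + 1 → (q k).Monic) (hdeg : ∀ k, k ≤ n + 1 → (q k).natDegree = k)
    (horth : ∀ k, k ≤ n + 1 → ∀ G : ℝ[X], G.natDegree < k → ∑ l, ν l * (q k * G).eval (w l) = 0) {c : ℝ} (hcw : ∀ l, c < w l)
    {Q : ℝ[X]} (hQm : Q.Monic) (hQd : Q.natDegree = n + 1) (hQo : ∀ G : ℝ[X], G.natDegree < n + 1 → ∑ l, (ν l / (w l - c)) * (Q * G).eval (w l) = 0) :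
    Q = q (n + 1) - C ((∑ l, ν l * (q (n + 1)).eval (w l) / (w l - c)) / ∑ l, ν l * (q n).eval (w l) / (w l - c)) * q n := by
  have hF := (secondKindSum_ne_zero hν hw (by omega) (hmonic n (by omega)).ne_zero (hdeg n (by omega)) (horth n (by omega)) hcw).2
  have hν' : ∀ l, 0 < ν l / (w l - c) := fun l => div_pos (hν l) (sub_pos.2 (hcw l))
  have hlow : (C ((∑ l, ν l * (q (n + 1)).eval (w l) / (w l - c)) / ∑ l, ν l * (q n).eval (w l) / (w l - c)) * q n).natDegree < (q (n + 1)).natDegree := by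
    rw [hdeg (n + 1) le_rfl]
    exact lt_of_le_of_lt ((natDegree_C_mul_le _ _).trans (hdeg n (by omega)).le) (Nat.lt_succ_self n)
  have hPm : (q (n + 1) - C ((∑ l, ν l * (q (n + 1)).eval (w l) / (w l - c)) / ∑ l, ν l * (q n).eval (w l) / (w l - c)) * q n).Monic :=
    (hmonic (n + 1) le_rfl).sub_of_left (degree_lt_degree hlow)
  have hPd : (q (n + 1) - C ((∑ l, ν l * (q (n + 1)).eval (w l) / (w l - c)) / ∑ l, ν l * (q n).eval (w l) / (w l - c)) * q n).natDegree = n + 1 := by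
    rw [natDegree_sub_eq_left_of_natDegree_lt hlow, hdeg (n + 1) le_rfl]
  exact orthogonal_monic_unique hν' hw hnN hQm hQd hPm hPd hQo fun G hG => geronimus_orthogonal hdeg horth (fun l => (hcw l).ne') hF (by omega)

end Summit.Ventures.HSemireg.Wedge.HankelOuter
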